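import Summits.AtomisticToContinuum.HydrodynamicLimit.Theorems.InformationPercolationEngineChaosClosesEulerPressureValueC
import HarnessLib

/-!
# Window-to-cone step of `ParityBandClosure` — helper E: the time sandwich

Support file for the stub `stub_stressIsotropyOfWindowCovariance` of the line `transfer-weighted-parity-chain`
(skeleton v4) of the crux `JParityClosure.ParityBandClosure` (stmt-AtomisticToContinuum-17608).

WHAT.  Deterministic, one-dimensional bookkeeping in TIME.  With the tent `bt a = h⁻¹ (1 − |a|/h)₊` of half-width
`h` (in the application `h = r²`) and a time profile `φ` integrable on `[0, τ]` and bounded by `C` on `[0, t]`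
(`0 ≤ t ≤ τ`), the functional `∫_{[0,t]} φ` is, up to `4hC`, the TENT-WINDOWED functional
`∫_{t₀ ∈ [h, t − h]} ∫_{s ∈ [0,τ]} bt(s − t₀) φ(s) ds dt₀` (`abs_integral_sub_windowed_le`): insert
`1 = ∫ bt(s − t₀) dt₀`, swap the integrals (Fubini on `[h, t − h] × [0, τ]`), and pay the two end layers
`s ∈ [0, 2h) ∪ (t − 2h, t]` where the window mass `Θ(s) = ∫_{t₀ ∈ [h, t−h]} bt(s − t₀) dt₀ ∈ [0, 1]` is not `1`.
All windows `t₀ ∈ [h, t − h]` are FULL: `∫_{s ∈ [0,τ]} bt(s − t₀) ds = 1` (`window_mass_eq_one`).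

REFERENCES.  Elementary; the tent toolkit is `InformationPercolationEngineChaosClosesEulerPressureValueC.lean`.
-/

noncomputable section

namespace Summit.AtomisticToContinuum.HydrodynamicLimit.Theorems.ParityBandClosureWindowToCone

open scoped BigOperators Topology Classical MeasureTheory ENNReal
open Filter Set MeasureTheory Function
open Summit.AtomisticToContinuum.HydrodynamicLimit.Theorems.ChaosClosesEulerPressureValue
open Summit.AtomisticToContinuum.HydrodynamicLimit.Theorems.ChaosClosesEulerWindowedInvariance (tent_nonneg_le)

/-! ## §1 Window masses -/

/-- **Full windows**: if `[t₀ − h, t₀ + h] ⊆ [lo, hi]` then `∫_{s ∈ [lo,hi]} bt(s − t₀) ds = 1`. [folklore] -/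
theorem window_mass_eq_one {h : ℝ} (hh : 0 < h) {t₀ lo hi : ℝ} (hlo : lo ≤ t₀ - h) (hhi : t₀ + h ≤ hi) :
    ∫ s in Icc lo hi, h⁻¹ * max (1 - |s - t₀| / h) 0 = 1 := by
  have e : ∀ s, h⁻¹ * max (1 - |s - t₀| / h) 0 = h⁻¹ * max (1 - |t₀ - s| / h) 0 := fun s => by rw [abs_sub_comm]
  simp_rw [e]
  exact setIntegral_tent_eq_one hh (Icc_subset_Icc hlo hhi)

/-- Window masses are at most one. [folklore] -/
theorem window_mass_le_one {h : ℝ} (hh : 0 < h) (t₀ : ℝ) (S : Set ℝ) :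
    ∫ s in S, h⁻¹ * max (1 - |s - t₀| / h) 0 ≤ 1 := by
  have e : ∀ s, h⁻¹ * max (1 - |s - t₀| / h) 0 = h⁻¹ * max (1 - |t₀ - s| / h) 0 := fun s => by rw [abs_sub_comm]
  simp_rw [e]
  exact setIntegral_tent_le_one hh t₀ S

/-- The tent read forward from `t₀` is integrable on `ℝ`. [folklore] -/
theorem integrable_tent_sub' {h : ℝ} (hh : 0 < h) (t₀ : ℝ) :
    Integrable fun s : ℝ => h⁻¹ * max (1 - |s - t₀| / h) 0 := by
  have e : (fun s : ℝ => h⁻¹ * max (1 - |s - t₀| / h) 0) = fun s => h⁻¹ * max (1 - |t₀ - s| / h) 0 :=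
    funext fun s => by rw [abs_sub_comm]
  rw [e]; exact integrable_tent_sub hh t₀

/-! ## §2 Fubini for the tent-windowed functional -/

/-- The tent-weighted profile is integrable on the product `[lo, hi] × [0, τ]`. [folklore] -/
theorem integrable_tent_mul_prod {h : ℝ} (hh : 0 < h) (lo hi τ : ℝ) {φ : ℝ → ℝ} (hφ : IntegrableOn φ (Icc 0 τ) volume) :
    Integrable (uncurry fun t₀ s => h⁻¹ * max (1 - |s - t₀| / h) 0 * φ s)
      ((volume.restrict (Icc lo hi)).prod (volume.restrict (Icc 0 τ))) := by
  have hφ2 : Integrable (fun p : ℝ × ℝ => φ p.2) ((volume.restrict (Icc lo hi)).prod (volume.restrict (Icc 0 τ))) :=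
    hφ.comp_snd _
  have hcont : Continuous fun p : ℝ × ℝ => h⁻¹ * max (1 - |p.2 - p.1| / h) 0 := by fun_prop
  refine Integrable.mono' (hφ2.norm.const_mul h⁻¹) (hcont.aestronglyMeasurable.mul hφ2.aestronglyMeasurable)
    (ae_of_all _ fun p => ?_)
  simp only [uncurry, Real.norm_eq_abs, abs_mul, abs_of_nonneg (tent_nonneg_le hh _).1]
  exact mul_le_mul_of_nonneg_right (tent_nonneg_le hh _).2 (abs_nonneg _)

/-- **Fubini for the tent-windowed functional**:
`∫_{t₀ ∈ [lo,hi]} ∫_{s ∈ [0,τ]} bt(s − t₀) φ(s) = ∫_{s ∈ [0,τ]} Θ(s) φ(s)` with the window mass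
`Θ(s) = ∫_{t₀ ∈ [lo,hi]} bt(s − t₀) dt₀`, and `Θ φ` is integrable on `[0, τ]`. [folklore] -/
theorem integral_windowed_eq {h : ℝ} (hh : 0 < h) (lo hi τ : ℝ) {φ : ℝ → ℝ} (hφ : IntegrableOn φ (Icc 0 τ) volume) :
    (∫ t₀ in Icc lo hi, ∫ s in Icc 0 τ, h⁻¹ * max (1 - |s - t₀| / h) 0 * φ s) =
      ∫ s in Icc 0 τ, (∫ t₀ in Icc lo hi, h⁻¹ * max (1 - |s - t₀| / h) 0) * φ s ∧
    IntegrableOn (fun s => (∫ t₀ in Icc lo hi, h⁻¹ * max (1 - |s - t₀| / h) 0) * φ s) (Icc 0 τ) volume := by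
  have hint := integrable_tent_mul_prod hh lo hi τ hφ
  constructor
  · rw [integral_integral_swap hint]
    exact integral_congr_ae (ae_of_all _ fun s => integral_mul_const _ _)
  · have h2 := hint.swap.integral_prod_left
    exact h2.congr (ae_of_all _ fun s => by simp [uncurry, integral_mul_const])

/-! ## §3 The window mass `Θ` -/

/-- The window mass `Θ(s) = ∫_{t₀ ∈ [h, t−h]} bt(s − t₀) dt₀` is `1` on `[2h, t − 2h]`. [folklore] -/
theorem theta_eq_one {h : ℝ} (hh : 0 < h) {t s : ℝ} (hs1 : 2 * h ≤ s) (hs2 : s ≤ t - 2 * h) :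
    ∫ t₀ in Icc h (t - h), h⁻¹ * max (1 - |s - t₀| / h) 0 = 1 :=
  setIntegral_tent_eq_one hh (Icc_subset_Icc (by linarith) (by linarith))

/-- The window mass vanishes after `t`. [folklore] -/
theorem theta_eq_zero {h : ℝ} (hh : 0 < h) {t s : ℝ} (hs : t < s) :
    ∫ t₀ in Icc h (t - h), h⁻¹ * max (1 - |s - t₀| / h) 0 = 0 :=
  setIntegral_tent_eq_zero hh fun t₀ ht₀ => by
    rw [abs_of_nonneg (by linarith [ht₀.2])]; linarith [ht₀.2]

/-- `0 ≤ Θ ≤ 1`. [folklore] -/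
theorem theta_mem {h : ℝ} (hh : 0 < h) (t s : ℝ) :
    0 ≤ ∫ t₀ in Icc h (t - h), h⁻¹ * max (1 - |s - t₀| / h) 0 ∧
      ∫ t₀ in Icc h (t - h), h⁻¹ * max (1 - |s - t₀| / h) 0 ≤ 1 :=
  ⟨setIntegral_tent_nonneg hh s _, setIntegral_tent_le_one hh s _⟩

/-! ## §4 The time sandwich -/

/-- Real volume of a sub-interval event of `[0, t]`: `vol([0,t] ∩ (−∞, 2h)) ≤ 2h` (`h > 0`). [folklore] -/
theorem volume_real_Icc_inter_Iio_le {h : ℝ} (hh : 0 < h) (t : ℝ) :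
    (volume (Icc 0 t ∩ Iio (2 * h))).toReal ≤ 2 * h := by
  have hsub : Icc 0 t ∩ Iio (2 * h) ⊆ Icc 0 (2 * h) := fun s hs => ⟨hs.1.1, le_of_lt hs.2⟩
  calc (volume (Icc 0 t ∩ Iio (2 * h))).toReal ≤ (volume (Icc (0 : ℝ) (2 * h))).toReal :=
        ENNReal.toReal_mono (by rw [Real.volume_Icc]; exact ENNReal.ofReal_ne_top) (measure_mono hsub)
    _ = 2 * h := by rw [Real.volume_Icc, ENNReal.toReal_ofReal (by linarith)]; ring

/-- Real volume of a sub-interval event of `[0, t]`: `vol([0,t] ∩ (t − 2h, ∞)) ≤ 2h` (`h > 0`). [folklore] -/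
theorem volume_real_Icc_inter_Ioi_le {h : ℝ} (hh : 0 < h) (t : ℝ) :
    (volume (Icc 0 t ∩ Ioi (t - 2 * h))).toReal ≤ 2 * h := by
  have hsub : Icc 0 t ∩ Ioi (t - 2 * h) ⊆ Icc (t - 2 * h) t := fun s hs => ⟨le_of_lt hs.2, hs.1.2⟩
  calc (volume (Icc 0 t ∩ Ioi (t - 2 * h))).toReal ≤ (volume (Icc (t - 2 * h) t)).toReal :=
        ENNReal.toReal_mono (by rw [Real.volume_Icc]; exact ENNReal.ofReal_ne_top) (measure_mono hsub)
    _ = 2 * h := by rw [Real.volume_Icc, ENNReal.toReal_ofReal (by linarith)]; ring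

/-- **THE TIME SANDWICH.**  For `0 < h`, `0 ≤ t ≤ τ`, `φ` integrable on `[0, τ]` with `|φ| ≤ C` on `[0, t]`:
`|∫_{[0,t]} φ − ∫_{t₀ ∈ [h, t−h]} ∫_{s ∈ [0,τ]} bt(s − t₀) φ(s)| ≤ 4hC`. [folklore] -/
theorem abs_integral_sub_windowed_le {h : ℝ} (hh : 0 < h) {t τ : ℝ} (ht : 0 ≤ t) (htτ : t ≤ τ) {φ : ℝ → ℝ}
    (hφ : IntegrableOn φ (Icc 0 τ) volume) {C : ℝ} (hC : ∀ s ∈ Icc 0 t, |φ s| ≤ C) :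
    |(∫ s in Icc 0 t, φ s) - ∫ t₀ in Icc h (t - h), ∫ s in Icc 0 τ, h⁻¹ * max (1 - |s - t₀| / h) 0 * φ s| ≤
      4 * h * C := by
  have hC0 : 0 ≤ C := (abs_nonneg _).trans (hC 0 ⟨le_rfl, ht⟩)
  obtain ⟨hswap, hΘφ⟩ := integral_windowed_eq hh h (t - h) τ hφ
  set Θ : ℝ → ℝ := fun s => ∫ t₀ in Icc h (t - h), h⁻¹ * max (1 - |s - t₀| / h) 0 with hΘ
  -- restrict the windowed functional to `[0, t]`
  have hsplit : ∫ s in Icc 0 τ, Θ s * φ s = ∫ s in Icc 0 t, Θ s * φ s := by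
    have hU := Icc_union_Ioc_eq_Icc ht htτ
    have hdisj : Disjoint (Icc (0 : ℝ) t) (Ioc t τ) := by
      rw [Set.disjoint_left]
      intro s hs hs'
      exact (not_lt.2 hs.2) hs'.1
    rw [← hU, setIntegral_union hdisj measurableSet_Ioc
      (hΘφ.mono_set (hU ▸ subset_union_left)) (hΘφ.mono_set (hU ▸ subset_union_right))]
    rw [setIntegral_eq_zero_of_forall_eq_zero (t := Ioc t τ) fun s hs => ?_, add_zero]
    show Θ s * φ s = 0
    rw [hΘ]; dsimp only; rw [theta_eq_zero hh hs.1, zero_mul]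
  have hφt : IntegrableOn φ (Icc 0 t) volume := hφ.mono_set (Icc_subset_Icc le_rfl htτ)
  have hΘφt : IntegrableOn (fun s => Θ s * φ s) (Icc 0 t) volume := hΘφ.mono_set (Icc_subset_Icc le_rfl htτ)
  have hdiff : (∫ s in Icc 0 t, φ s) - ∫ t₀ in Icc h (t - h), ∫ s in Icc 0 τ, h⁻¹ * max (1 - |s - t₀| / h) 0 * φ s =
      ∫ s in Icc 0 t, (1 - Θ s) * φ s := by
    rw [hswap]
    change (∫ s in Icc 0 t, φ s) - ∫ s in Icc 0 τ, Θ s * φ s = ∫ s in Icc 0 t, (1 - Θ s) * φ s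
    rw [hsplit, ← integral_sub hφt hΘφt]
    exact integral_congr_ae (ae_of_all _ fun s => by ring)
  rw [hdiff]
  -- the end layers
  have hmeas1 : MeasurableSet (Iio (2 * h) : Set ℝ) := measurableSet_Iio
  have hmeas2 : MeasurableSet (Ioi (t - 2 * h) : Set ℝ) := measurableSet_Ioi
  have hpt : ∀ s ∈ Icc 0 t, ‖(1 - Θ s) * φ s‖ ≤
      C * ((Iio (2 * h)).indicator (fun _ => (1 : ℝ)) s + (Ioi (t - 2 * h)).indicator (fun _ => (1 : ℝ)) s) := by
    intro s hs
    have hΘs := theta_mem hh t s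
    rw [Real.norm_eq_abs, abs_mul]
    by_cases h1 : s < 2 * h
    · rw [Set.indicator_of_mem (show s ∈ Iio (2 * h) from h1)]
      have h2 : (0 : ℝ) ≤ (Ioi (t - 2 * h)).indicator (fun _ => (1 : ℝ)) s := Set.indicator_nonneg (fun _ _ => zero_le_one) _
      have h3 : |1 - Θ s| ≤ 1 := by rw [abs_le]; constructor <;> linarith [hΘs.1, hΘs.2]
      nlinarith [hC s hs, abs_nonneg (φ s), abs_nonneg (1 - Θ s)]
    by_cases h2 : t - 2 * h < s
    · rw [Set.indicator_of_mem (show s ∈ Ioi (t - 2 * h) from h2)]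
      have h2' : (0 : ℝ) ≤ (Iio (2 * h)).indicator (fun _ => (1 : ℝ)) s := Set.indicator_nonneg (fun _ _ => zero_le_one) _
      have h3 : |1 - Θ s| ≤ 1 := by rw [abs_le]; constructor <;> linarith [hΘs.1, hΘs.2]
      nlinarith [hC s hs, abs_nonneg (φ s), abs_nonneg (1 - Θ s)]
    · have hone : Θ s = 1 := theta_eq_one hh (not_lt.1 h1) (not_lt.1 h2)
      rw [hone, sub_self, abs_zero, zero_mul]
      exact mul_nonneg hC0 (add_nonneg (Set.indicator_nonneg (fun _ _ => zero_le_one) _)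
        (Set.indicator_nonneg (fun _ _ => zero_le_one) _))
  have hind : IntegrableOn (fun s => C * ((Iio (2 * h)).indicator (fun _ => (1 : ℝ)) s +
      (Ioi (t - 2 * h)).indicator (fun _ => (1 : ℝ)) s)) (Icc 0 t) volume :=
    (((integrable_const (1 : ℝ)).indicator hmeas1).add ((integrable_const (1 : ℝ)).indicator hmeas2)).const_mul C
  calc |∫ s in Icc 0 t, (1 - Θ s) * φ s| ≤ ∫ s in Icc 0 t, ‖(1 - Θ s) * φ s‖ := by
        rw [← Real.norm_eq_abs]; exact norm_integral_le_integral_norm _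
    _ ≤ ∫ s in Icc 0 t, C * ((Iio (2 * h)).indicator (fun _ => (1 : ℝ)) s +
          (Ioi (t - 2 * h)).indicator (fun _ => (1 : ℝ)) s) :=
        setIntegral_mono_on (hφt.sub hΘφt |>.congr (by
          exact ae_of_all _ fun s => by simp only [Pi.sub_apply]; ring)).norm hind measurableSet_Icc hpt
    _ = C * ((volume (Icc 0 t ∩ Iio (2 * h))).toReal + (volume (Icc 0 t ∩ Ioi (t - 2 * h))).toReal) := by
        rw [integral_const_mul, integral_add ((integrable_const (1 : ℝ)).indicator hmeas1)
          ((integrable_const (1 : ℝ)).indicator hmeas2), integral_indicator_const _ hmeas1,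
          integral_indicator_const _ hmeas2]
        simp only [smul_eq_mul, mul_one, measureReal_def, Measure.restrict_apply hmeas1, Measure.restrict_apply hmeas2,
          Set.inter_comm]
    _ ≤ C * (2 * h + 2 * h) := by
        gcongr
        · exact volume_real_Icc_inter_Iio_le hh t
        · exact volume_real_Icc_inter_Ioi_le hh t
    _ = 4 * h * C := by ring

/-- **Full windows inside the sandwich**: for `t₀ ∈ [h, t − h]` with `t ≤ τ`, the window `[t₀ − h, t₀ + h]` lies in
`[0, τ]` and `∫_{s ∈ [0,τ]} bt(s − t₀) ds = 1`. [folklore] -/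
theorem window_mass_eq_one_of_mem {h : ℝ} (hh : 0 < h) {t τ t₀ : ℝ} (htτ : t ≤ τ) (ht₀ : t₀ ∈ Icc h (t - h)) :
    ∫ s in Icc 0 τ, h⁻¹ * max (1 - |s - t₀| / h) 0 = 1 :=
  window_mass_eq_one hh (by linarith [ht₀.1]) (by linarith [ht₀.2])

/-- Inside the sandwich the tent kills every instant after `t`: for `t₀ ∈ [h, t − h]` and `t < s`,
`bt(s − t₀) = 0`. [folklore] -/
theorem tent_eq_zero_of_lt {h : ℝ} (hh : 0 < h) {t t₀ s : ℝ} (ht₀ : t₀ ∈ Icc h (t - h)) (hs : t < s) :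
    h⁻¹ * max (1 - |s - t₀| / h) 0 = 0 :=
  tent_eq_zero_of_le hh (by rw [abs_of_nonneg (by linarith [ht₀.2])]; linarith [ht₀.2])

/-! ## §5 Registered sub-goal -/

/-- **Registered sub-goal `stub_stressIsotropyOfWindowCovarianceE` (helper E of
`stub_stressIsotropyOfWindowCovariance`): the time sandwich** — for `0 < h`, `0 ≤ t ≤ τ`, `φ` integrable on
`[0, τ]` and bounded by `C` on `[0, t]`, the plain time integral of `φ` over `[0, t]` is within `4hC` of its
tent-windowed version over the full windows `t₀ ∈ [h, t − h]`. [folklore] -/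
theorem stub_stressIsotropyOfWindowCovarianceE : ∀ {h : ℝ}, 0 < h → ∀ {t τ : ℝ}, 0 ≤ t → t ≤ τ → ∀ {φ : ℝ → ℝ}, MeasureTheory.IntegrableOn φ (Set.Icc 0 τ) MeasureTheory.volume → ∀ {C : ℝ}, (∀ s ∈ Set.Icc 0 t, |φ s| ≤ C) → |(∫ s in Set.Icc 0 t, φ s) - ∫ t₀ in Set.Icc h (t - h), ∫ s in Set.Icc 0 τ, h⁻¹ * max (1 - |s - t₀| / h) 0 * φ s| ≤ 4 * h * C :=
  fun hh _ _ ht htτ _ hφ _ hC => abs_integral_sub_windowed_le hh ht htτ hφ hC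

end Summit.AtomisticToContinuum.HydrodynamicLimit.Theorems.ParityBandClosureWindowToCone

end
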